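import Literature.MathematicalPhysics.QuantumFieldTheory.Balaban1983to89.B6Ineq243TwoLevelBox

/-!
# `Balaban1983to89.B6Ineq244TwoLevelCutoff` — [B6] (2.44) with the printed `O(M^{−1})` for the GENUINE two-level cube
operator at mesh `L^{−j}`: an explicit cut-off family of scale `M` meeting the hypotheses of
`B6Ineq243TwoLevelBox.ineq244_twoLevel` with `κ₁ = 4(d+1)/M`, `κ₂ = 64(d+1)/M²` (no existing module is touched; no
fact is minted)

FRAMING (verbatim cell line; v1.1 DOCFIX, referee asks ref-3 N-g26-1 / ref-4 g20 / ref-1 g29 / lead g6 — it was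
missing from v1; prose only, no declaration changed):
statement-level skeleton of published theorems with citation tags; proofs where landed; nothing here is a claim about the Yang–Mills mass gap

Source under audit (cell pub-balaban): T. Bałaban, *Propagators and renormalization transformations for lattice gauge
theories. II*, Commun. Math. Phys. **96** (1984) 223–250 [`Balaban1984PropagatorsII`, "B6"], p. 229 [PDF 7] (2.36)–(2.39),
p. 230 [PDF 8] (2.40), (2.43)–(2.44) (renders `b2b-balaban-ref1/pages/1984-cmp96-propagators-rt-II/…-p007-x2.png`,
`…-p008-x2.png`, read as images).

## WHAT IS PRINTED (pp. 229–230, verbatim up to notation)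

p. 229: «We cover B^j(Λ_j) by a sum of cubes □ of the size 2ML^jη, each cube being a sum of 2^d big blocks with a
center y ∈ Λ_j … We construct also the corresponding family of functions h described in (1.118), and rescale them to
proper scales. They satisfy Σ_{□∈𝒟} h_□² = 1. (2.36)»; «Δ′_aG′₀ = I − Σ_□ K(h_□)G′(□)h_□ = I − R, (2.38) where
(K(h)λ)(x) = Σ_{b∈st(x)}(∂h)(b)(∂λ)(b) − (Δh)(x)λ(x) − a_j(L^jη)^{−2}Σ_{x′∈B^j(y^j(x))}L^{−jd}(∂h)(Γ^{(j)}_{x,y^j(x),x′})λ(x′)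
if x ∈ B^j(Λ_j). (2.39)».  p. 230: «This inequality [(2.43)] and (2.40) imply
|(K(h_□)G′(□)h_□λ)(x)| ≤ O(M^{−1})e^{−δ₀|x−y|}|λ| (2.44) if either supp λ ⊂ B^j(y) for y ∈ Λ_j, or
supp λ ⊂ B^{j+1}(y) for y ∈ Λ_{j+1}. The distance in the above inequality is measured on L^{−j}-scale.»
(v1.1 DOCFIX, ref-1 g29 erratum candidate: v1 elided the proviso «if either supp λ ⊂ B^j(y) … or supp λ ⊂
B^{j+1}(y) …» of (2.44); it is restored verbatim here. The theorem `ineq244_twoLevel_cutoff` below is stated for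
EVERY `g` with the rate `e^{−δ′dist(x, supp g)}`, which contains the printed case `supp λ ⊂ B^j(y)` /
`B^{j+1}(y)`: there `dist(x, supp λ) ≥ |x − y| − diam B^{j+1}(y)` and `diam B^{j+1}(y) ≤ L` on the `L^{−j}`-scale,
so `e^{−δ′dist(x, supp λ)} ≤ e^{δ′L}e^{−δ′|x − y|}`, the factor `e^{δ′L}` joining the constant `C = C(d, ℓ, window)`
of HONEST SCOPE below (`δ′` is A positive rate, not the `δ₀` of [3] — unchanged from v1). Wider in scope than
print, no content changed.)

## WHAT THIS FILE CERTIFIES (kernel-checked; `A = 0`)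

`B6Ineq243TwoLevelBox.ineq244_twoLevel` (v1.1) proves (2.44) at mesh `L^{−j}` for the genuine two-level operator with
`O(M^{−1})` replaced by `C(κ₁ + κ₂)`, `κ₁`/`κ₂` the unit-scale Lipschitz constant / Laplacian bound of the cut-off `h`.
Here the two sizes are PRODUCED for an explicit family:
* `bumpR` — the `C^{1,1}` bump `φ(t) = (1 − min(1,|t|)²)²` (`= (1 − t²)²` on `[−1,1]`, `0` outside): `4`-Lipschitz
  (`abs_bumpR_sub_le`) with second differences `|φ(t+δ) + φ(t−δ) − 2φ(t)| ≤ 64δ²` (`abs_bumpR_second_diff_le`);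
* `cutoffZ n M c` — the cut-off `h(z) = Π_μ φ((z_μ/n − c_μ)/M)` of scale `M` (unit-lattice units; «Λ_j is scaled to
  unit lattice», cubes «of the size 2M») centred at `c`, at mesh `1/n = L^{−j}`: `0 ≤ h ≤ 1`,
  **`cutoffZ_lipschitz`** `|h(z′) − h(z)| ≤ (4(d+1)/M)|z′ − z|_∞/n` and **`cutoffZ_laplacian`**
  `|n²Σ_{x″∼x, x″∈□}(h(x″) − h(x))| ≤ 64(d+1)/M²` at EVERY point of the box, provided the support cube sits three units
  inside the box (`M + 3 ≤ c_μ`, `c_μ + M + 3 ≤ LM′_μ`; near the faces every term vanishes, `cutoffZ_eq_zero_near_face`);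
* **`ineq244_twoLevel_cutoff`** — (2.44) WITH THE PRINTED `O(M^{−1})`: for every window there are `δ′, C > 0` with
  `|(K(h)G′(□)g)(x)| ≤ (C/M)e^{−δ′dist(x, supp g)}‖g‖_∞` for EVERY `j ≥ 1`, box of `L`-blocks, block union `Λ`, scale
  `M ≥ 1`, admissible centre `c` and every `g` (e.g. `g = h_□λ`).

## HONEST SCOPE

* `A = 0`; the cut-off family is AN admissible `C^{1,1}` family of scale `M` (sufficient for (2.44)), NOT the printed
  `C₀^∞` partition family of (2.36)/[B5] (1.118) (`Σh_□² = 1` is not claimed for it; the one-scale printed family is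
  `B6CoverBox.hprof`, whose profile is only Lipschitz); the box (Neumann) operator stands for the torus `Δ′_a` as in
  `B6Ineq243TwoLevelBox` §8; constants depend on `d`, `ℓ` and the window.
* Nothing is inferred from the manuscript: every step is kernel-checked; the quoted sentences locate the statement.

Value = kernel certificate that the hypotheses of the mesh-`L^{−j}` (2.44) are met with the printed rate `M^{−1}`; NOT
summit progress.
-/

namespace Literature.MathematicalPhysics.QuantumFieldTheory.Balaban1983to89.B6Ineq244TwoLevelCutoff

open Finset Matrix
open Literature.MathematicalPhysics.QuantumFieldTheory.Balaban1983to89.B4ContourShift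
open Literature.MathematicalPhysics.QuantumFieldTheory.Balaban1983to89.B4Reflection242
open Literature.MathematicalPhysics.QuantumFieldTheory.Balaban1983to89.B4Green242Bridge
open Literature.MathematicalPhysics.QuantumFieldTheory.Balaban1983to89.B4BoxCov237
open Literature.MathematicalPhysics.QuantumFieldTheory.Balaban1983to89.B4Thm110ZeroBox
open Literature.MathematicalPhysics.QuantumFieldTheory.Balaban1983to89.B6Ineq243TwoLevelBox

noncomputable section

variable {d : ℕ}

/-! ## §1 An admissible cut-off of scale `M` at mesh `L^{−j}`: the sizes `κ₁ = O(M^{−1})`, `κ₂ = O(M^{−2})` of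
`ineq244_twoLevel` are attained by a `C^{1,1}` bump (so (2.44) holds with the printed `O(M^{−1})`) -/


/-- the clipped parabola `ψ(t) = 1 − min(1, |t|)² = max(0, 1 − t²) ∈ [0, 1]`. [folklore] -/
def psiR (t : ℝ) : ℝ := 1 - (min 1 |t|) ^ 2

/-- the `C^{1,1}` bump `φ = ψ²`: `(1 − t²)²` on `[−1, 1]`, `0` outside (a cut-off «equal to 1 at the centre and with
support in the doubled interval», cf. the profiles `h ∈ C₀^∞(]−⅔, ⅔[)` of [B5] (1.118) behind (2.36); any `C^{1,1}`
profile serves (2.44)). [cite: Balaban1984PropagatorsII, (2.36) p.229 with (2.40)/(2.44) p.230] -/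
def bumpR (t : ℝ) : ℝ := psiR t ^ 2

/-- `0 ≤ min(1, |t|)`. [folklore] -/
private theorem min_one_abs_nonneg (t : ℝ) : 0 ≤ min 1 |t| := le_min zero_le_one (abs_nonneg t)

/-- `min(1, |t|) ≤ 1`. [folklore] -/
private theorem min_one_abs_le_one (t : ℝ) : min 1 |t| ≤ 1 := min_le_left _ _

/-- `0 ≤ ψ`. [folklore] -/
private theorem psiR_nonneg (t : ℝ) : 0 ≤ psiR t := by
  unfold psiR
  have h0 := min_one_abs_nonneg t
  have h1 := min_one_abs_le_one t
  nlinarith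

/-- `ψ ≤ 1`. [folklore] -/
private theorem psiR_le_one (t : ℝ) : psiR t ≤ 1 := by
  unfold psiR
  nlinarith [sq_nonneg (min 1 |t|)]

/-- `ψ(t) = 1 − t²` on `[−1, 1]`. [folklore] -/
private theorem psiR_of_abs_le {t : ℝ} (h : |t| ≤ 1) : psiR t = 1 - t ^ 2 := by
  unfold psiR
  rw [min_eq_right h, sq_abs]

/-- `ψ(t) = 0` for `|t| ≥ 1`. [folklore] -/
private theorem psiR_of_le_abs {t : ℝ} (h : 1 ≤ |t|) : psiR t = 0 := by
  unfold psiR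
  rw [min_eq_left h]
  ring

/-- `0 ≤ φ ≤ 1`. [cite: Balaban1984PropagatorsII, (2.36) p.229, bookkeeping] -/
theorem bumpR_nonneg (t : ℝ) : 0 ≤ bumpR t := sq_nonneg _

/-- `φ ≤ 1`. [cite: Balaban1984PropagatorsII, (2.36) p.229, bookkeeping] -/
theorem bumpR_le_one (t : ℝ) : bumpR t ≤ 1 := by
  unfold bumpR
  have h0 := psiR_nonneg t
  have h1 := psiR_le_one t
  nlinarith

/-- `φ(t) = (1 − t²)²` for `|t| ≤ 1`. [cite: Balaban1984PropagatorsII, (2.36) p.229, bookkeeping] -/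
theorem bumpR_of_abs_le {t : ℝ} (h : |t| ≤ 1) : bumpR t = (1 - t ^ 2) ^ 2 := by
  unfold bumpR
  rw [psiR_of_abs_le h]

/-- `φ(t) = 0` for `|t| ≥ 1`. [cite: Balaban1984PropagatorsII, (2.36) p.229, bookkeeping] -/
theorem bumpR_of_le_abs {t : ℝ} (h : 1 ≤ |t|) : bumpR t = 0 := by
  unfold bumpR
  rw [psiR_of_le_abs h]
  ring

/-- `ψ` is `2`-Lipschitz. [folklore] -/
private theorem abs_psiR_sub_le (s s' : ℝ) : |psiR s - psiR s'| ≤ 2 * |s - s'| := by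
  unfold psiR
  have hu := min_one_abs_nonneg s
  have hu1 := min_one_abs_le_one s
  have hv := min_one_abs_nonneg s'
  have hv1 := min_one_abs_le_one s'
  have h1 : abs (min 1 |s| - min 1 |s'|) ≤ |s - s'| := by
    refine (abs_min_sub_min_le_max _ _ _ _).trans ?_
    rw [sub_self, abs_zero, max_eq_right (abs_nonneg _)]
    exact abs_abs_sub_abs_le_abs_sub s s'
  rw [show (1 : ℝ) - min 1 |s| ^ 2 - (1 - min 1 |s'| ^ 2)
      = (min 1 |s'| - min 1 |s|) * (min 1 |s'| + min 1 |s|) by ring, abs_mul,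
    abs_of_nonneg (by linarith : (0 : ℝ) ≤ min 1 |s'| + min 1 |s|), abs_sub_comm]
  calc abs (min 1 |s| - min 1 |s'|) * (min 1 |s'| + min 1 |s|) ≤ |s - s'| * 2 :=
        mul_le_mul h1 (by linarith) (by linarith) (abs_nonneg _)
    _ = 2 * |s - s'| := by ring

/-- `φ` is `4`-Lipschitz. [cite: Balaban1984PropagatorsII, (2.40) p.230 («∂h»), bookkeeping] -/
theorem abs_bumpR_sub_le (s s' : ℝ) : |bumpR s - bumpR s'| ≤ 4 * |s - s'| := by
  unfold bumpR
  rw [sq_sub_sq, abs_mul]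
  have h1 : |psiR s + psiR s'| ≤ 2 := by
    rw [abs_of_nonneg (add_nonneg (psiR_nonneg s) (psiR_nonneg s'))]
    linarith [psiR_le_one s, psiR_le_one s']
  calc |psiR s + psiR s'| * |psiR s - psiR s'| ≤ 2 * (2 * |s - s'|) :=
        mul_le_mul h1 (abs_psiR_sub_le s s') (abs_nonneg _) zero_le_two
    _ = 4 * |s - s'| := by ring

/-- near a point outside `[−1, 1]` the bump is quadratically small: `1 < |s′|`, `|s − s′| ≤ 2δ` ⟹ `φ(s) ≤ 16δ²`.
[folklore] -/
private theorem bumpR_le_of_near {s s' δ : ℝ} (hs' : 1 < |s'|) (hd : |s - s'| ≤ 2 * δ) : bumpR s ≤ 16 * δ ^ 2 := by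
  by_cases hs : 1 ≤ |s|
  · rw [bumpR_of_le_abs hs]; positivity
  · rw [not_le] at hs
    rw [bumpR_of_abs_le hs.le]
    have h1 : 1 - |s| ≤ 2 * δ := by
      have := abs_sub_abs_le_abs_sub s' s
      rw [abs_sub_comm] at this
      linarith
    have h2 : 0 ≤ 1 - s ^ 2 := by nlinarith [abs_nonneg s, sq_abs s]
    have h3 : 1 - s ^ 2 ≤ 4 * δ := by nlinarith [sq_abs s, abs_nonneg s]
    nlinarith

/-- **SECOND DIFFERENCES OF THE BUMP ARE `O(δ²)`**: `|φ(t + δ) + φ(t − δ) − 2φ(t)| ≤ 64δ²` (`φ ∈ C^{1,1}`).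
[cite: Balaban1984PropagatorsII, (2.40) p.230 («Δh»), bookkeeping] -/
theorem abs_bumpR_second_diff_le (t : ℝ) {δ : ℝ} (hδ : 0 ≤ δ) :
    |bumpR (t + δ) + bumpR (t - δ) - 2 * bumpR t| ≤ 64 * δ ^ 2 := by
  by_cases hall : |t + δ| ≤ 1 ∧ |t - δ| ≤ 1
  · obtain ⟨h1, h2⟩ := hall
    have ht : |t| ≤ 1 := abs_le.2 ⟨by linarith [(abs_le.1 h2).1], by linarith [(abs_le.1 h1).2]⟩
    have hδ1 : δ ≤ 1 := by linarith [(abs_le.1 h1).2, (abs_le.1 h2).1]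
    rw [bumpR_of_abs_le h1, bumpR_of_abs_le h2, bumpR_of_abs_le ht,
      show (1 - (t + δ) ^ 2) ^ 2 + (1 - (t - δ) ^ 2) ^ 2 - 2 * (1 - t ^ 2) ^ 2
        = δ ^ 2 * (12 * t ^ 2 - 4) + 2 * δ ^ 4 by ring]
    have ht2 : t ^ 2 ≤ 1 := by nlinarith [abs_nonneg t, sq_abs t]
    have hd4 : δ ^ 4 ≤ δ ^ 2 := by
      have hδ2 : δ ^ 2 ≤ 1 := by nlinarith
      calc δ ^ 4 = δ ^ 2 * δ ^ 2 := by ring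
        _ ≤ δ ^ 2 * 1 := mul_le_mul_of_nonneg_left hδ2 (sq_nonneg δ)
        _ = δ ^ 2 := mul_one _
    rw [abs_le]
    constructor
    · nlinarith [sq_nonneg t, sq_nonneg δ, sq_nonneg (δ ^ 2)]
    · nlinarith [sq_nonneg δ]
  · rw [not_and_or] at hall
    obtain ⟨s', hs', hd1, hd2, hd3⟩ : ∃ s', 1 < |s'| ∧ |t + δ - s'| ≤ 2 * δ ∧ |t - δ - s'| ≤ 2 * δ ∧
        |t - s'| ≤ 2 * δ := by
      rcases hall with h | h
      · refine ⟨t + δ, lt_of_not_ge h, ?_, ?_, ?_⟩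
        · rw [sub_self, abs_zero]; linarith
        · rw [show t - δ - (t + δ) = -(2 * δ) by ring, abs_neg, abs_of_nonneg (by linarith)]
        · rw [show t - (t + δ) = -δ by ring, abs_neg, abs_of_nonneg hδ]; linarith
      · refine ⟨t - δ, lt_of_not_ge h, ?_, ?_, ?_⟩
        · rw [show t + δ - (t - δ) = 2 * δ by ring, abs_of_nonneg (by linarith)]
        · rw [sub_self, abs_zero]; linarith
        · rw [show t - (t - δ) = δ by ring, abs_of_nonneg hδ]; linarith
    have b1 := bumpR_le_of_near hs' hd1
    have b2 := bumpR_le_of_near hs' hd2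
    have b3 := bumpR_le_of_near hs' hd3
    have n1 := bumpR_nonneg (t + δ)
    have n2 := bumpR_nonneg (t - δ)
    have n3 := bumpR_nonneg t
    rw [abs_le]
    constructor <;> nlinarith

/-- `|Π_i a_i − Π_i b_i| ≤ Σ_i |a_i − b_i|` for factors in `[0, 1]`. [folklore] -/
private theorem abs_prod_sub_prod_le' {ι : Type*} (s : Finset ι) {f g : ι → ℝ} (hf : ∀ i, 0 ≤ f i ∧ f i ≤ 1)
    (hg : ∀ i, 0 ≤ g i ∧ g i ≤ 1) : |∏ i ∈ s, f i - ∏ i ∈ s, g i| ≤ ∑ i ∈ s, |f i - g i| := by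
  classical
  refine Finset.induction_on s ?_ ?_
  · simp
  · intro a s has ih
    rw [Finset.prod_insert has, Finset.prod_insert has, Finset.sum_insert has]
    have hQ0 : 0 ≤ ∏ i ∈ s, g i := Finset.prod_nonneg fun i _ => (hg i).1
    have hQ1 : ∏ i ∈ s, g i ≤ 1 := Finset.prod_le_one (fun i _ => (hg i).1) fun i _ => (hg i).2
    have hfa := hf a
    calc |f a * ∏ i ∈ s, f i - g a * ∏ i ∈ s, g i|
        = |f a * (∏ i ∈ s, f i - ∏ i ∈ s, g i) + (f a - g a) * ∏ i ∈ s, g i| := by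
          congr 1
          ring
      _ ≤ |f a * (∏ i ∈ s, f i - ∏ i ∈ s, g i)| + |(f a - g a) * ∏ i ∈ s, g i| := abs_add_le _ _
      _ = f a * |∏ i ∈ s, f i - ∏ i ∈ s, g i| + |f a - g a| * ∏ i ∈ s, g i := by
          rw [abs_mul, abs_mul, abs_of_nonneg hfa.1, abs_of_nonneg hQ0]
      _ ≤ 1 * (∑ i ∈ s, |f i - g i|) + |f a - g a| * 1 :=
          add_le_add (mul_le_mul hfa.2 ih (abs_nonneg _) zero_le_one)
            (mul_le_mul_of_nonneg_left hQ1 (abs_nonneg _))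
      _ = |f a - g a| + ∑ i ∈ s, |f i - g i| := by ring

/-- **THE CUT-OFF OF SCALE `M` AT MESH `1/n`**: `h(z) = Π_μ φ((z_μ/n − c_μ)/M)` on `ℤ^{d+1}` (`c` = centre in unit-
lattice coordinates, `M` = the size of the big blocks in unit-lattice units, as for the rescaled `h_□` of (2.36):
«Λ_j is scaled to unit lattice», «cubes □ of the size 2M»). [cite: Balaban1984PropagatorsII, (2.36) p.229] -/
def cutoffZ (n : ℕ) (M : ℝ) (c : Fin (d + 1) → ℝ) (z : Fin (d + 1) → ℤ) : ℝ :=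
  ∏ μ, bumpR ((((z μ : ℤ) : ℝ) / n - c μ) / M)

/-- `0 ≤ h ≤ 1`. [cite: Balaban1984PropagatorsII, (2.36) p.229, bookkeeping] -/
theorem cutoffZ_nonneg (n : ℕ) (M : ℝ) (c : Fin (d + 1) → ℝ) (z : Fin (d + 1) → ℤ) : 0 ≤ cutoffZ n M c z :=
  Finset.prod_nonneg fun _ _ => bumpR_nonneg _

/-- `h ≤ 1`. [cite: Balaban1984PropagatorsII, (2.36) p.229, bookkeeping] -/
theorem cutoffZ_le_one (n : ℕ) (M : ℝ) (c : Fin (d + 1) → ℝ) (z : Fin (d + 1) → ℤ) : cutoffZ n M c z ≤ 1 :=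
  Finset.prod_le_one (fun _ _ => bumpR_nonneg _) fun _ _ => bumpR_le_one _

/-- **UNIT-SCALE LIPSCHITZ CONSTANT `κ₁ = 4(d+1)/M`**: `|h(z′) − h(z)| ≤ (4(d+1)/M)·|z′ − z|_∞/n`.
[cite: Balaban1984PropagatorsII, (2.40)/(2.44) p.230 («∂h = O(M^{−1})»)] -/
theorem cutoffZ_lipschitz {n : ℕ} (hn : 1 ≤ n) {M : ℝ} (hM : 0 < M) (c : Fin (d + 1) → ℝ)
    (z z' : Fin (d + 1) → ℤ) :
    |cutoffZ n M c z' - cutoffZ n M c z| ≤ 4 * (d + 1) / M * supNorm (z' - z) / n := by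
  have hn' : (0 : ℝ) < n := by exact_mod_cast hn
  unfold cutoffZ
  calc |∏ μ, bumpR ((((z' μ : ℤ) : ℝ) / n - c μ) / M) - ∏ μ, bumpR ((((z μ : ℤ) : ℝ) / n - c μ) / M)|
      ≤ ∑ μ, |bumpR ((((z' μ : ℤ) : ℝ) / n - c μ) / M) - bumpR ((((z μ : ℤ) : ℝ) / n - c μ) / M)| :=
        abs_prod_sub_prod_le' _ (fun μ => ⟨bumpR_nonneg _, bumpR_le_one _⟩)
          (fun μ => ⟨bumpR_nonneg _, bumpR_le_one _⟩)
    _ ≤ ∑ _μ : Fin (d + 1), 4 / M * supNorm (z' - z) / n := by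
        refine Finset.sum_le_sum fun μ _ => ?_
        refine (abs_bumpR_sub_le _ _).trans ?_
        rw [show (((z' μ : ℤ) : ℝ) / n - c μ) / M - ((((z μ : ℤ) : ℝ) / n - c μ) / M)
            = ((((z' μ : ℤ) : ℝ)) - ((z μ : ℤ) : ℝ)) / (n * M) by field_simp; ring, abs_div,
          abs_of_pos (by positivity : (0 : ℝ) < n * M)]
        have h1 : |(((z' μ : ℤ) : ℝ)) - ((z μ : ℤ) : ℝ)| ≤ supNorm (z' - z) := by
          have := abs_le_supNorm (z' - z) μ
          rw [Pi.sub_apply] at this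
          push_cast at this
          exact this
        calc 4 * (|(((z' μ : ℤ) : ℝ)) - ((z μ : ℤ) : ℝ)| / ((n : ℝ) * M))
            ≤ 4 * (supNorm (z' - z) / ((n : ℝ) * M)) := by gcongr
          _ = 4 / M * supNorm (z' - z) / n := by
              field_simp
    _ = 4 * (d + 1) / M * supNorm (z' - z) / n := by
        rw [Finset.sum_const, Finset.card_univ, Fintype.card_fin, nsmul_eq_mul]
        push_cast
        ring

/-- a vanishing factor kills the cut-off. [cite: Balaban1984PropagatorsII, (2.36) p.229, bookkeeping] -/
theorem cutoffZ_eq_zero_of_factor {n : ℕ} {M : ℝ} {c : Fin (d + 1) → ℝ} {z : Fin (d + 1) → ℤ} (μ : Fin (d + 1))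
    (h : bumpR ((((z μ : ℤ) : ℝ) / n - c μ) / M) = 0) : cutoffZ n M c z = 0 :=
  Finset.prod_eq_zero (Finset.mem_univ μ) h

/-- **THE CUT-OFF VANISHES NEAR THE FACES OF THE BOX** when its support cube sits three units inside
(`M + 3 ≤ c_μ`, `c_μ + M + 3 ≤ N_μ/n`): at every lattice point with `z_μ ≤ 2` or `z_μ ≥ N_μ − 3` for some `μ`.
[cite: Balaban1984PropagatorsII, (2.36) p.229 (cubes inside the region), bookkeeping] -/
theorem cutoffZ_eq_zero_near_face {n : ℕ} (hn : 1 ≤ n) {M : ℝ} (hM : 0 < M) {c : Fin (d + 1) → ℝ}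
    {N : Fin (d + 1) → ℕ} (hc : ∀ μ, M + 3 ≤ c μ ∧ c μ + M + 3 ≤ (N μ : ℝ) / n) {z : Fin (d + 1) → ℤ}
    {μ : Fin (d + 1)} (hz : z μ ≤ 2 ∨ (N μ : ℤ) - 3 ≤ z μ) : cutoffZ n M c z = 0 := by
  have hn' : (0 : ℝ) < n := by exact_mod_cast hn
  have hn1 : (1 : ℝ) ≤ n := by exact_mod_cast hn
  obtain ⟨hc1, hc2⟩ := hc μ
  apply cutoffZ_eq_zero_of_factor μ
  apply bumpR_of_le_abs
  rcases hz with hz | hz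
  · -- left face: t ≤ −1
    have hzr : ((z μ : ℤ) : ℝ) ≤ 2 := by exact_mod_cast hz
    have h1 : ((z μ : ℤ) : ℝ) / n ≤ 2 := by
      rw [div_le_iff₀ hn']; nlinarith
    have h2 : (((z μ : ℤ) : ℝ) / n - c μ) / M ≤ -1 := by
      rw [div_le_iff₀ hM]; linarith
    rw [le_abs]
    right
    linarith
  · -- right face: t ≥ 1
    have hzr : ((N μ : ℤ) : ℝ) - 3 ≤ ((z μ : ℤ) : ℝ) := by exact_mod_cast hz
    have h1 : (N μ : ℝ) / n - 3 ≤ ((z μ : ℤ) : ℝ) / n := by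
      have : (N μ : ℝ) / n - 3 ≤ ((N μ : ℝ) - 3) / n := by
        rw [sub_div, sub_le_sub_iff_left, div_le_iff₀ hn']
        nlinarith
      refine this.trans ?_
      rw [div_le_div_iff_of_pos_right hn']
      push_cast at hzr ⊢
      linarith
    have h2 : 1 ≤ (((z μ : ℤ) : ℝ) / n - c μ) / M := by
      rw [le_div_iff₀ hM]; linarith
    exact le_trans h2 (le_abs_self _)

/-- the sum over the nearest neighbours (real-valued). [folklore] -/
private theorem sum_nbrs_real (φ : (Fin (d + 1) → ℤ) → ℝ) (x : Fin (d + 1) → ℤ) :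
    ∑ z ∈ nbrs x, φ z = ∑ μ, φ (x + Pi.single μ 1) + ∑ μ, φ (x - Pi.single μ 1) := by
  have h := sum_nbrs (fun z => (φ z : ℂ)) x
  exact_mod_cast h

/-- for an interior point the in-box neighbour sum is the full lattice neighbour sum. [folklore] -/
private theorem sum_boxNbrs_eq_sum_nbrs {N : Fin (d + 1) → ℕ} (x : ↥(boxDom N)) (hsub : nbrs x.1 ⊆ boxDom N)
    (f : (Fin (d + 1) → ℤ) → ℝ) : ∑ x'' ∈ boxNbrs N x, f x''.1 = ∑ z ∈ nbrs x.1, f z := by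
  classical
  unfold boxNbrs
  rw [Finset.sum_filter, Finset.sum_coe_sort (boxDom N) (fun z => if z ∈ nbrs x.1 then f z else 0),
    ← Finset.sum_filter, Finset.filter_mem_eq_inter, Finset.inter_eq_right.2 hsub]

/-- **UNIT-SCALE LAPLACIAN BOUND `κ₂ = 64(d+1)/M²`**: for the cut-off of scale `M` at mesh `1/n` whose support cube sits
three units inside the box, `|n²·Σ_{x″ ∼ x, x″ ∈ □}(h(x″) − h(x))| ≤ 64(d+1)/M²` at EVERY point of the box (interior
points: second differences of the `C^{1,1}` bump; points near the faces: every term vanishes).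
[cite: Balaban1984PropagatorsII, (2.40)/(2.44) p.230 («Δh», «O(M^{−1})»)] -/
theorem cutoffZ_laplacian {n : ℕ} (hn : 1 ≤ n) {M : ℝ} (hM : 0 < M) (c : Fin (d + 1) → ℝ)
    {N : Fin (d + 1) → ℕ} (hc : ∀ μ, M + 3 ≤ c μ ∧ c μ + M + 3 ≤ (N μ : ℝ) / n) (x : ↥(boxDom N)) :
    |(n : ℝ) ^ 2 * ∑ x'' ∈ boxNbrs N x, (cutoffZ n M c x''.1 - cutoffZ n M c x.1)| ≤ 64 * (d + 1) / M ^ 2 := by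
  have hn' : (0 : ℝ) < n := by exact_mod_cast hn
  have hx := mem_boxDom.1 x.2
  by_cases hint : ∀ μ, 1 ≤ x.1 μ ∧ x.1 μ + 2 ≤ N μ
  · -- interior point: all lattice neighbours lie in the box
    have hsub : nbrs x.1 ⊆ boxDom N := by
      intro z hz
      rw [mem_boxDom]
      obtain ⟨i, rfl | rfl⟩ := mem_nbrs.1 hz <;> intro j <;> obtain ⟨h1, h2⟩ := hint j <;>
        obtain ⟨h3, h4⟩ := hx j
      · by_cases hji : j = i
        · subst hji; simp; constructor <;> omega
        · simp [hji]; exact ⟨h3, h4⟩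
      · by_cases hji : j = i
        · subst hji; simp; constructor <;> omega
        · simp [hji]; exact ⟨h3, h4⟩
    rw [sum_boxNbrs_eq_sum_nbrs x hsub (fun z => cutoffZ n M c z - cutoffZ n M c x.1), sum_nbrs_real,
      ← Finset.sum_add_distrib]
    -- per direction: the product splits off the μ-th factor
    set t : Fin (d + 1) → ℝ := fun ν => (((x.1 ν : ℤ) : ℝ) / n - c ν) / M with ht
    set δ : ℝ := 1 / ((n : ℝ) * M) with hδ
    have hδ0 : 0 ≤ δ := by positivity
    have hP : ∀ μ : Fin (d + 1), 0 ≤ ∏ ν ∈ Finset.univ.erase μ, bumpR (t ν)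
        ∧ ∏ ν ∈ Finset.univ.erase μ, bumpR (t ν) ≤ 1 := fun μ =>
      ⟨Finset.prod_nonneg fun _ _ => bumpR_nonneg _,
        Finset.prod_le_one (fun _ _ => bumpR_nonneg _) fun _ _ => bumpR_le_one _⟩
    have hsplit : ∀ (μ : Fin (d + 1)) (s : ℤ), cutoffZ n M c (x.1 + Pi.single μ s)
        = bumpR (t μ + (s : ℝ) * δ) * ∏ ν ∈ Finset.univ.erase μ, bumpR (t ν) := by
      intro μ s
      unfold cutoffZ
      rw [← Finset.mul_prod_erase Finset.univ _ (Finset.mem_univ μ)]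
      congr 1
      · congr 1
        simp only [ht, hδ, Pi.add_apply, Pi.single_eq_same]
        push_cast
        field_simp
        ring
      · refine Finset.prod_congr rfl fun ν hν => ?_
        have hνμ : ν ≠ μ := Finset.ne_of_mem_erase hν
        simp [ht, Pi.single_eq_of_ne hνμ]
    have hterm : ∀ μ : Fin (d + 1), (cutoffZ n M c (x.1 + Pi.single μ 1) - cutoffZ n M c x.1)
        + (cutoffZ n M c (x.1 - Pi.single μ 1) - cutoffZ n M c x.1)
        = (∏ ν ∈ Finset.univ.erase μ, bumpR (t ν))
          * (bumpR (t μ + δ) + bumpR (t μ - δ) - 2 * bumpR (t μ)) := by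
      intro μ
      have e1 := hsplit μ 1
      have e2 := hsplit μ (-1)
      have e0 := hsplit μ 0
      rw [Pi.single_zero, add_zero, Int.cast_zero, zero_mul, add_zero] at e0
      rw [Int.cast_one, one_mul] at e1
      rw [Int.cast_neg, Int.cast_one, neg_one_mul, ← sub_eq_add_neg] at e2
      rw [show x.1 - Pi.single μ (1 : ℤ) = x.1 + Pi.single μ (-1) by
        rw [Pi.single_neg, sub_eq_add_neg], e1, e2, e0]
      ring
    rw [Finset.sum_congr rfl fun μ _ => hterm μ, Finset.mul_sum]
    calc |∑ μ : Fin (d + 1), (n : ℝ) ^ 2 * ((∏ ν ∈ Finset.univ.erase μ, bumpR (t ν))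
          * (bumpR (t μ + δ) + bumpR (t μ - δ) - 2 * bumpR (t μ)))|
        ≤ ∑ μ : Fin (d + 1), |(n : ℝ) ^ 2 * ((∏ ν ∈ Finset.univ.erase μ, bumpR (t ν))
          * (bumpR (t μ + δ) + bumpR (t μ - δ) - 2 * bumpR (t μ)))| := Finset.abs_sum_le_sum_abs _ _
      _ ≤ ∑ _μ : Fin (d + 1), (n : ℝ) ^ 2 * (64 * δ ^ 2) := by
          refine Finset.sum_le_sum fun μ _ => ?_
          rw [abs_mul, abs_mul, abs_of_nonneg (by positivity : (0 : ℝ) ≤ (n : ℝ) ^ 2),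
            abs_of_nonneg (hP μ).1]
          refine mul_le_mul_of_nonneg_left ?_ (by positivity)
          calc (∏ ν ∈ Finset.univ.erase μ, bumpR (t ν)) * |bumpR (t μ + δ) + bumpR (t μ - δ) - 2 * bumpR (t μ)|
              ≤ 1 * (64 * δ ^ 2) :=
                mul_le_mul (hP μ).2 (abs_bumpR_second_diff_le (t μ) hδ0) (abs_nonneg _) zero_le_one
            _ = 64 * δ ^ 2 := one_mul _
      _ = 64 * (d + 1) / M ^ 2 := by
          rw [Finset.sum_const, Finset.card_univ, Fintype.card_fin, nsmul_eq_mul, hδ]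
          push_cast
          field_simp
  · -- near a face: the cut-off vanishes at x and at all its in-box neighbours
    rw [not_forall] at hint
    obtain ⟨μ, hμ⟩ := hint
    rw [not_and_or, not_le, not_le] at hμ
    have hxz : x.1 μ ≤ 2 ∨ (N μ : ℤ) - 3 ≤ x.1 μ := by
      rcases hμ with h | h
      · left; omega
      · right; have := (hx μ).2; omega
    have h0 : cutoffZ n M c x.1 = 0 := cutoffZ_eq_zero_near_face hn hM hc hxz
    have hterm : ∀ x'' ∈ boxNbrs N x, cutoffZ n M c x''.1 - cutoffZ n M c x.1 = 0 := by
      intro x'' hx''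
      have hmem := hx''
      unfold boxNbrs at hmem
      simp only [Finset.mem_filter, Finset.mem_univ, true_and] at hmem
      have hco : |x''.1 μ - x.1 μ| ≤ 1 := by
        obtain ⟨i, e | e⟩ := mem_nbrs.1 hmem
        · rw [e]; by_cases h : μ = i
          · subst h; simp
          · simp [h]
        · rw [e]; by_cases h : μ = i
          · subst h; simp
          · simp [h]
      have hz'' : x''.1 μ ≤ 2 ∨ (N μ : ℤ) - 3 ≤ x''.1 μ := by
        have := abs_le.1 hco
        rcases hμ with h | h
        · left; omega
        · right; omega
      rw [h0, cutoffZ_eq_zero_near_face hn hM hc hz'', sub_zero]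
    rw [Finset.sum_congr rfl hterm, Finset.sum_const_zero, mul_zero, abs_zero]
    positivity


/-- **[B6] (2.44) WITH THE PRINTED `O(M^{−1})`, FOR THE GENUINE TWO-LEVEL CUBE OPERATOR AT MESH `L^{−j}`**: for every
dimension, block size and window there are `δ′, C > 0` such that for EVERY `j ≥ 1`, every point of the window, every box
built of `L`-blocks, every block union `Λ`, every scale `M ≥ 1` and every cut-off `h(x) = Π_μφ((x_μ/L^j − c_μ)/M)` of
scale `M` whose support cube sits three units inside the box, every `g` with `|g| ≤ F` and every `D ≤ dist_∞(x, supp g)`: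
`|(K(h)G′(□)g)(x)| ≤ (C/M)·e^{−δ′D/L^j}·F`. (= `ineq244_twoLevel` with `κ₁ = 4(d+1)/M`, `κ₂ = 64(d+1)/M²`.)
[cite: Balaban1984PropagatorsII, (2.44) p.230] -/
theorem ineq244_twoLevel_cutoff (d ℓ : ℕ) (hℓ : 1 ≤ ℓ) (aminus aplus m2plus a2minus a2plus : ℝ) (ha : 0 < aminus)
    (ha2 : 0 < a2minus) :
    ∃ δ' C : ℝ, 0 < δ' ∧ 0 < C ∧ ∀ (k : ℕ), 1 ≤ k → ∀ (aj m2 a : ℝ), aminus ≤ aj → aj ≤ aplus → 0 ≤ m2 →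
      m2 ≤ m2plus → a2minus ≤ a → a ≤ a2plus → ∀ (M' : Fin (d + 1) → ℕ), (∀ i, 1 ≤ M' i) →
        ∀ (Λ : Finset ↥(boxDom (fun i => (ℓ + 1) * M' i))), IsBlockUnion ℓ M' Λ →
        ∀ (M : ℝ), 1 ≤ M → ∀ (c : Fin (d + 1) → ℝ),
          (∀ μ, M + 3 ≤ c μ ∧ c μ + M + 3 ≤ ((ℓ : ℝ) + 1) * M' μ) →
          ∀ (g : ↥(boxDom (fun i => (ℓ + 1) ^ k * ((ℓ + 1) * M' i))) → ℝ) (F Dd : ℝ), (∀ x', |g x'| ≤ F) →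
          ∀ x : ↥(boxDom (fun i => (ℓ + 1) ^ k * ((ℓ + 1) * M' i))),
            (∀ x', g x' ≠ 0 → Dd ≤ supNorm (x.1 - x'.1)) →
              |(kComm (twoLevelOp ((ℓ + 1) ^ k) ℓ aj a m2 M' Λ) (fun z => cutoffZ ((ℓ + 1) ^ k) M c z.1)
                  *ᵥ (gTwoLevel ((ℓ + 1) ^ k) ℓ aj a m2 M' Λ *ᵥ g)) x|
                ≤ C / M * Real.exp (-(δ' * Dd / (((ℓ + 1) ^ k : ℕ) : ℝ))) * F := by
  obtain ⟨δ', C₀, hδ', hC₀, h⟩ := ineq244_twoLevel d ℓ hℓ aminus aplus m2plus a2minus a2plus ha ha2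
  refine ⟨δ', C₀ * (68 * (d + 1)), hδ', by positivity, ?_⟩
  intro k hk aj m2 a e1 e2 e3 e4 e5 e6 M' hM Λ hΛ M hM1 c hc g F Dd hF x hD
  have hn1 : 1 ≤ (ℓ + 1) ^ k := Nat.one_le_pow _ _ (by omega)
  have hn' : (0 : ℝ) < (((ℓ + 1) ^ k : ℕ) : ℝ) := by exact_mod_cast hn1
  have hM0 : 0 < M := by linarith
  have hF0 : 0 ≤ F := (abs_nonneg _).trans (hF x)
  have hc' : ∀ μ, M + 3 ≤ c μ ∧ c μ + M + 3
      ≤ ((((ℓ + 1) ^ k * ((ℓ + 1) * M' μ) : ℕ)) : ℝ) / (((ℓ + 1) ^ k : ℕ) : ℝ) := by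
    intro μ
    refine ⟨(hc μ).1, ?_⟩
    rw [show ((((ℓ + 1) ^ k * ((ℓ + 1) * M' μ) : ℕ)) : ℝ) / (((ℓ + 1) ^ k : ℕ) : ℝ) = ((ℓ : ℝ) + 1) * M' μ by
      rw [Nat.cast_mul, mul_div_cancel_left₀ _ hn'.ne']
      push_cast
      ring]
    exact (hc μ).2
  have hLip : ∀ z z' : ↥(boxDom (fun i => (ℓ + 1) ^ k * ((ℓ + 1) * M' i))),
      |cutoffZ ((ℓ + 1) ^ k) M c z'.1 - cutoffZ ((ℓ + 1) ^ k) M c z.1|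
        ≤ 4 * (d + 1) / M * supNorm (z'.1 - z.1) / (((ℓ + 1) ^ k : ℕ) : ℝ) :=
    fun z z' => cutoffZ_lipschitz hn1 hM0 c z.1 z'.1
  have hLap : ∀ z : ↥(boxDom (fun i => (ℓ + 1) ^ k * ((ℓ + 1) * M' i))),
      |(((ℓ + 1) ^ k : ℕ) : ℝ) ^ 2 * ∑ z' ∈ boxNbrs _ z, (cutoffZ ((ℓ + 1) ^ k) M c z'.1 - cutoffZ ((ℓ + 1) ^ k) M c z.1)|
        ≤ 64 * (d + 1) / M ^ 2 :=
    fun z => cutoffZ_laplacian hn1 hM0 c hc' z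
  have hmain := h k hk aj m2 a e1 e2 e3 e4 e5 e6 M' hM Λ hΛ (fun z => cutoffZ ((ℓ + 1) ^ k) M c z.1)
    (4 * (d + 1) / M) (64 * (d + 1) / M ^ 2) (by positivity) hLip hLap g F Dd hF x hD
  refine hmain.trans ?_
  have hE := Real.exp_pos (-(δ' * Dd / ((((ℓ + 1) ^ k : ℕ)) : ℝ)))
  have hκ : C₀ * (4 * (d + 1) / M + 64 * (d + 1) / M ^ 2) ≤ C₀ * (68 * (d + 1)) / M := by
    have hMM : M ≤ M ^ 2 := by nlinarith
    have h64 : 64 * ((d : ℝ) + 1) / M ^ 2 ≤ 64 * ((d : ℝ) + 1) / M :=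
      div_le_div_of_nonneg_left (by positivity) hM0 hMM
    have key : 4 * ((d : ℝ) + 1) / M + 64 * ((d : ℝ) + 1) / M ^ 2 ≤ 68 * ((d : ℝ) + 1) / M := by
      have : 4 * ((d : ℝ) + 1) / M + 64 * ((d : ℝ) + 1) / M = 68 * ((d : ℝ) + 1) / M := by ring
      linarith
    calc C₀ * (4 * (d + 1) / M + 64 * (d + 1) / M ^ 2) ≤ C₀ * (68 * ((d : ℝ) + 1) / M) :=
          mul_le_mul_of_nonneg_left key hC₀.le
      _ = C₀ * (68 * (d + 1)) / M := by ring
  exact mul_le_mul_of_nonneg_right (mul_le_mul_of_nonneg_right hκ hE.le) hF0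



/-! ## §2 Non-vacuity (`d + 1 = 4`, `L = 2`, windows `[1/2, 2]`, `[0, 1]`, `[1/2, 2]`) -/

/-- (2.44) with the printed `O(M^{−1})` at the physical dimension. -/
example : ∃ δ' C : ℝ, 0 < δ' ∧ 0 < C ∧ ∀ (k : ℕ), 1 ≤ k → ∀ (aj m2 a : ℝ), (1 / 2 : ℝ) ≤ aj → aj ≤ 2 → 0 ≤ m2 →
    m2 ≤ 1 → (1 / 2 : ℝ) ≤ a → a ≤ 2 → ∀ (M' : Fin (3 + 1) → ℕ), (∀ i, 1 ≤ M' i) →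
      ∀ (Λ : Finset ↥(boxDom (fun i => (1 + 1) * M' i))), IsBlockUnion 1 M' Λ →
      ∀ (M : ℝ), 1 ≤ M → ∀ (c : Fin (3 + 1) → ℝ), (∀ μ, M + 3 ≤ c μ ∧ c μ + M + 3 ≤ (((1 : ℕ) : ℝ) + 1) * M' μ) →
        ∀ (g : ↥(boxDom (fun i => (1 + 1) ^ k * ((1 + 1) * M' i))) → ℝ) (F Dd : ℝ), (∀ x', |g x'| ≤ F) →
        ∀ x : ↥(boxDom (fun i => (1 + 1) ^ k * ((1 + 1) * M' i))),
          (∀ x', g x' ≠ 0 → Dd ≤ supNorm (x.1 - x'.1)) →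
            |(kComm (twoLevelOp ((1 + 1) ^ k) 1 aj a m2 M' Λ) (fun z => cutoffZ ((1 + 1) ^ k) M c z.1)
                *ᵥ (gTwoLevel ((1 + 1) ^ k) 1 aj a m2 M' Λ *ᵥ g)) x|
              ≤ C / M * Real.exp (-(δ' * Dd / (((1 + 1) ^ k : ℕ) : ℝ))) * F :=
  ineq244_twoLevel_cutoff 3 1 le_rfl (1 / 2) 2 1 (1 / 2) 2 (by norm_num) (by norm_num)

/-- the admissible-centre condition is met: on the unit cube of `L`-blocks with `M′ ≡ 9` (unit box side `18`), the
scale `M = 1` and the centre `c ≡ 9` satisfy `M + 3 ≤ c_μ` and `c_μ + M + 3 ≤ 18`. -/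
example : ∀ μ : Fin (3 + 1), (1 : ℝ) + 3 ≤ (fun _ => (9 : ℝ)) μ ∧
    (fun _ => (9 : ℝ)) μ + 1 + 3 ≤ ((1 : ℝ) + 1) * ((fun _ => 9 : Fin (3 + 1) → ℕ) μ : ℕ) := by
  intro μ
  norm_num

/-- the bump is not identically zero (`φ(0) = 1`), so the cut-off is a genuine cut-off. -/
example : bumpR 0 = 1 := by
  rw [bumpR_of_abs_le (by norm_num)]
  norm_num

end

end Literature.MathematicalPhysics.QuantumFieldTheory.Balaban1983to89.B6Ineq244TwoLevelCutoff
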